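import Literature.AnabelianGeometry.EtaleTheta.ConstantMultipleRigiditySub
import HarnessLib

/-!
# [EtTh] Thm. 1.10 (i), row T110.i.r7: the `±1`-clause of `Thm110DeltaCompat` is automatic
# (K2 residual trimming, abc-iut-w5-d140)

[EtTh] Thm. 1.10 (i) p.255 [cite: MochizukiEtTh2009, Thm 1.10 (i) p.29]; row r7 of this seat's gen-0
`ConstantMultipleRigiditySub.lean` (p417168) typed `Thm110DeltaCompat δ` = «`δ : K̈^×_α ≃ K̈^×_β` respects
`O^×`, the order by `|·|`, and `±1`».  PROOF-ONLY: the third clause is a consequence of `δ` being a GROUP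
isomorphism — `±1` are exactly the elements of `K̈^×` whose square is `1` (a field of characteristic `0`) — so
the genuine content of r7 is the first two clauses ([AbsAnab] Prop. 1.2.1: units and valuation are
group-theoretic).  `Thm110DeltaCompat.of_units_of_order` packages this.  Nothing of [EtTh] is asserted; no
side taken on [IUTchIII] Cor. 3.12.
-/

noncomputable section

namespace Literature.AnabelianGeometry.EtaleTheta

open Literature.AnabelianGeometry.SemiGraphs

variable {p : ℕ} [Fact p.Prime]

namespace MuTwoSetting

variable {M : MuTwoSetting p}

/-- In `K̈^× ⊆ ℚ̄_p^×`: `v = ±1` iff `v² = 1` (as units of `K̈`). [folklore] -/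
private theorem coe_eq_one_or_neg_one_iff_sq (v : (↥M.Kdd)ˣ) :
    (((v : M.Kdd) : PadicAlgCl p) = 1 ∨ ((v : M.Kdd) : PadicAlgCl p) = -1) ↔ v ^ 2 = 1 := by
  rw [← sq_eq_one_iff, ← Units.val_inj, Units.val_pow_eq_pow_val, Units.val_one]
  constructor
  · intro h
    apply Subtype.ext
    have : (((v : M.Kdd) ^ 2 : M.Kdd) : PadicAlgCl p) = ((v : M.Kdd) : PadicAlgCl p) ^ 2 := by
      simp
    change (((v : M.Kdd) ^ 2 : M.Kdd) : PadicAlgCl p) = ((1 : M.Kdd) : PadicAlgCl p)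
    rw [this, h]
    simp
  · intro h
    have h' := congrArg (fun x : M.Kdd => (x : PadicAlgCl p)) h
    simpa using h'

end MuTwoSetting

section Thm110

variable {Mα Mβ : MuTwoSetting p}

/-- **A group isomorphism `δ : K̈^×_α ≃ K̈^×_β` automatically carries `±1` to `±1`** (the elements of
square `1`). [cite: MochizukiEtTh2009, Thm 1.10 (i) p.29] -/
theorem deltaCompat_sign (δ : (↥Mα.Kdd)ˣ ≃* (↥Mβ.Kdd)ˣ) (v : (↥Mα.Kdd)ˣ) :
    (((v : Mα.Kdd) : PadicAlgCl p) = 1 ∨ ((v : Mα.Kdd) : PadicAlgCl p) = -1) ↔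
      (((δ v : Mβ.Kdd) : PadicAlgCl p) = 1 ∨ ((δ v : Mβ.Kdd) : PadicAlgCl p) = -1) := by
  rw [MuTwoSetting.coe_eq_one_or_neg_one_iff_sq, MuTwoSetting.coe_eq_one_or_neg_one_iff_sq, ← map_pow,
    ← δ.map_one, δ.injective.eq_iff]

/-- **Row T110.i.r7 trimmed**: `Thm110DeltaCompat δ` from its two genuine clauses — `δ` respects the units
`O^×_{K̈}` and the order by absolute value ([AbsAnab] Prop. 1.2.1 (ii)(iii)(v)); the `±1`-clause is free.
[cite: MochizukiEtTh2009, Thm 1.10 (i) p.29] -/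
theorem Thm110DeltaCompat.of_units_of_order (δ : (↥Mα.Kdd)ˣ ≃* (↥Mβ.Kdd)ˣ)
    (hU : ∀ u : (↥Mα.Kdd)ˣ, u ∈ Mα.toThetaSetting.unitsOKdd ↔ δ u ∈ Mβ.toThetaSetting.unitsOKdd)
    (hord : ∀ v w : (↥Mα.Kdd)ˣ,
      ‖((δ v : Mβ.Kdd) : PadicAlgCl p)‖ ≤ ‖((δ w : Mβ.Kdd) : PadicAlgCl p)‖ ↔
        ‖((v : Mα.Kdd) : PadicAlgCl p)‖ ≤ ‖((w : Mα.Kdd) : PadicAlgCl p)‖) :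
    Thm110DeltaCompat (Mα := Mα) (Mβ := Mβ) δ :=
  ⟨hU, hord, fun v => deltaCompat_sign δ v⟩

end Thm110

end Literature.AnabelianGeometry.EtaleTheta

end
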